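import Literature.NumberTheory.LFunctions.SelbergMollifierLemma1018
import HarnessLib

/-!
# Titchmarsh's Lemma 10.17: `∫ |∫_t^{t+H} F|² dt = O(H/(δ^{1/2} log X))` — PROVED

Ninth support file for the proof of A. Selberg's positive-proportion theorem in the arrangement
of E. C. Titchmarsh, *The Theory of the Riemann Zeta-Function*, 2nd ed. (1986), §10.9–§10.22.
It discharges the named fact `Titchmarsh1986_lemma_10_17` of `SelbergMollifier.lean`:
`theorem Titchmarsh1986_lemma_10_17_holds`.

Proof (Titchmarsh §10.17, with two elementary replacements). By Parseval for the window
(`integral_selbergWindow_sq_eq`), `∫|∫_t^{t+H}F|² = 2π∫_0^∞ |f̃(v)|²|k_H(v)|²` with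
`|k_H(v)| ≤ min(H, 4/v)`; splitting at `v = 4/H` and passing to `x = e^{v/2}` (`G = e^{2/H} = X^{2a}`)
gives `≤ 2π[16H² ∫_1^G |g|² + 8H²P₀² + 64 ∫_G^∞ |g|²/log²x]`.
* `∫_1^G |g|²`: instead of Titchmarsh's integration by parts we use dyadic blocks:
  `∫_{2^k}^{2^{k+1}}|g|² ≤ 2^{(k+1)/2} J(2^k,½) = O(1/(δ^{1/2}log X))` by (10.17.2), and there are
  `O(log G)` blocks.
* `∫_G^∞ |g|²/log² x`: instead of Titchmarsh's `θ`-integral `1/log²x = ∫_0^∞ θx^{-θ}dθ` we use the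
  one-term bound `1/log²x ≤ 4·2^{-2k-3} x^{-2^{-k-2}}` for `2^{k+2} ≤ log x < 2^{k+3}`, so that on
  `[G, δ^{-2}]` finitely many `J(G, 2^{-k-2})` suffice, each `O(2^k e^{-2^{-k-2}log G}/(δ^{1/2}log X))`
  by (10.17.2), summing to `O(1/(log G · δ^{1/2} log X)) = O(H/(δ^{1/2}log X))`; beyond `δ^{-2}` the
  Gaussian tail of `g` is negligible (`gaussTail_le_one`).

## References

* [Titchmarsh1986] E. C. Titchmarsh, *The Theory of the Riemann Zeta-Function*, 2nd ed. revised by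
  D. R. Heath-Brown, Oxford 1986, §10.17, Lemma 10.17.
-/

noncomputable section

open Real Complex MeasureTheory Set Filter Finset
open scoped Topology

namespace Literature.NumberTheory.LFunctions.SelbergMollifier

/-! ## §1 Dyadic bound for `∫_1^G |g|²` -/

section Dyadic

variable {X δ : ℝ}

/-- `∫_{(1,2^n]} = ∑_{k<n} ∫_{(2^k, 2^{k+1}]}` for `|g|²`. [folklore] -/
theorem integral_Ioc_pow_two_eq_sum (hX : 0 < X) (hδ : 0 < Real.sin δ) (n : ℕ) :
    ∫ u in Ioc (1 : ℝ) (2 ^ n), ‖gfun X δ u‖ ^ 2 =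
      ∑ k ∈ Finset.range n, ∫ u in Ioc ((2 : ℝ) ^ k) (2 ^ (k + 1)), ‖gfun X δ u‖ ^ 2 := by
  induction n with
  | zero => simp
  | succ n ih =>
    rw [Finset.sum_range_succ, ← ih]
    have h1 : (1 : ℝ) ≤ 2 ^ n := one_le_pow₀ (by norm_num)
    have h2 : (2 : ℝ) ^ n ≤ 2 ^ (n + 1) := pow_le_pow_right₀ (by norm_num) (Nat.le_succ n)
    rw [← Ioc_union_Ioc_eq_Ioc h1 h2, setIntegral_union (Ioc_disjoint_Ioc_of_le le_rfl) measurableSet_Ioc]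
    · exact (integrableOn_norm_gfun_sq hX hδ le_rfl).mono_set Ioc_subset_Ioi_self
    · exact (integrableOn_norm_gfun_sq hX hδ h1).mono_set Ioc_subset_Ioi_self

/-- **One dyadic block**: `∫_{2^k}^{2^{k+1}} |g|² ≤ √2 · M` if `J(2^k, ½) ≤ M/√(2^k)`. [cite: Titchmarsh1986, §10.17] -/
theorem integral_dyadic_block_le (hX : 0 < X) (hδ : 0 < Real.sin δ) (k : ℕ) {M : ℝ}
    (hJ : Jint X δ ((2 : ℝ) ^ k) (1 / 2) ≤ M / Real.sqrt ((2 : ℝ) ^ k)) :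
    ∫ u in Ioc ((2 : ℝ) ^ k) (2 ^ (k + 1)), ‖gfun X δ u‖ ^ 2 ≤ Real.sqrt 2 * M := by
  have h2k : (1 : ℝ) ≤ 2 ^ k := one_le_pow₀ (by norm_num)
  have h2k0 : (0 : ℝ) < 2 ^ k := by positivity
  have hint := integrableOn_norm_gfun_sq_rpow hX hδ (by norm_num : (0 : ℝ) ≤ 1 / 2) h2k
  set s : ℝ := Real.sqrt ((2 : ℝ) ^ (k + 1)) with hs
  have hs0 : 0 < s := Real.sqrt_pos.mpr (by positivity)
  calc ∫ u in Ioc ((2 : ℝ) ^ k) (2 ^ (k + 1)), ‖gfun X δ u‖ ^ 2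
      ≤ ∫ u in Ioc ((2 : ℝ) ^ k) (2 ^ (k + 1)), s * (‖gfun X δ u‖ ^ 2 * u ^ (-(1 / 2 : ℝ))) := by
        refine setIntegral_mono_on ((integrableOn_norm_gfun_sq hX hδ h2k).mono_set Ioc_subset_Ioi_self)
          ((hint.mono_set Ioc_subset_Ioi_self).const_mul _) measurableSet_Ioc fun u hu ↦ ?_
        have hu0 : 0 < u := by linarith [hu.1]
        have h1 : 1 ≤ s * u ^ (-(1 / 2 : ℝ)) := by
          rw [Real.rpow_neg hu0.le, ← Real.sqrt_eq_rpow, ← div_eq_mul_inv, one_le_div (Real.sqrt_pos.mpr hu0), hs]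
          exact Real.sqrt_le_sqrt hu.2
        calc ‖gfun X δ u‖ ^ 2 = ‖gfun X δ u‖ ^ 2 * 1 := (mul_one _).symm
          _ ≤ ‖gfun X δ u‖ ^ 2 * (s * u ^ (-(1 / 2 : ℝ))) := mul_le_mul_of_nonneg_left h1 (sq_nonneg _)
          _ = _ := by ring
    _ = s * ∫ u in Ioc ((2 : ℝ) ^ k) (2 ^ (k + 1)), ‖gfun X δ u‖ ^ 2 * u ^ (-(1 / 2 : ℝ)) := integral_const_mul _ _
    _ ≤ s * Jint X δ ((2 : ℝ) ^ k) (1 / 2) := by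
        refine mul_le_mul_of_nonneg_left ?_ hs0.le
        rw [Jint]
        exact setIntegral_mono_set hint ((ae_restrict_iff' measurableSet_Ioi).mpr (Eventually.of_forall
          fun u hu ↦ by have : 0 ≤ u := le_of_lt (lt_trans h2k0 hu); positivity))
          (Eventually.of_forall Ioc_subset_Ioi_self)
    _ ≤ s * (M / Real.sqrt ((2 : ℝ) ^ k)) := mul_le_mul_of_nonneg_left hJ hs0.le
    _ = Real.sqrt 2 * M := by
        rw [hs, pow_succ, Real.sqrt_mul (by positivity)]
        field_simp

/-- **The dyadic bound**: if `J(x,½) ≤ M/√x` for `1 ≤ x < G`, then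
`∫_1^G |g|² ≤ (log G/log 2 + 1) √2 M` (`G ≥ 1`, `M ≥ 0`). [cite: Titchmarsh1986, §10.17] -/
theorem integral_Ioc_one_le_dyadic (hX : 0 < X) (hδ : 0 < Real.sin δ) {G M : ℝ} (hG : 1 ≤ G) (hM : 0 ≤ M)
    (hJ : ∀ x : ℝ, 1 ≤ x → x < G → Jint X δ x (1 / 2) ≤ M / Real.sqrt x) :
    ∫ u in Ioc 1 G, ‖gfun X δ u‖ ^ 2 ≤ (Real.log G / Real.log 2 + 1) * (Real.sqrt 2 * M) := by
  -- `n = ⌈log₂ G⌉`, `2^{n-1} < G ≤ 2^n`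
  set n : ℕ := ⌈Real.logb 2 G⌉₊ with hn
  have hlogb0 : 0 ≤ Real.logb 2 G := Real.logb_nonneg one_lt_two hG
  have hGn : G ≤ (2 : ℝ) ^ n := by
    have h1 : Real.logb 2 G ≤ n := Nat.le_ceil _
    calc G = (2 : ℝ) ^ Real.logb 2 G := (Real.rpow_logb two_pos (by norm_num) (by linarith)).symm
      _ ≤ (2 : ℝ) ^ (n : ℝ) := Real.rpow_le_rpow_of_exponent_le one_le_two h1
      _ = (2 : ℝ) ^ n := Real.rpow_natCast 2 n
  have hn1 : (n : ℝ) < Real.logb 2 G + 1 := Nat.ceil_lt_add_one hlogb0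
  have hblocks : ∀ k ∈ Finset.range n, ∫ u in Ioc ((2 : ℝ) ^ k) (2 ^ (k + 1)), ‖gfun X δ u‖ ^ 2 ≤ Real.sqrt 2 * M := by
    intro k hk
    have hk' : k + 1 ≤ n := Finset.mem_range.mp hk
    refine integral_dyadic_block_le hX hδ k (hJ _ (one_le_pow₀ (by norm_num)) ?_)
    -- `2^k < G` since `k ≤ n - 1 < log₂ G`
    have hklt : (k : ℝ) < Real.logb 2 G := by
      have : (k : ℝ) + 1 ≤ n := by exact_mod_cast hk'
      linarith
    calc (2 : ℝ) ^ k = (2 : ℝ) ^ (k : ℝ) := (Real.rpow_natCast 2 k).symm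
      _ < (2 : ℝ) ^ Real.logb 2 G := Real.rpow_lt_rpow_of_exponent_lt one_lt_two hklt
      _ = G := Real.rpow_logb two_pos (by norm_num) (by linarith)
  calc ∫ u in Ioc 1 G, ‖gfun X δ u‖ ^ 2 ≤ ∫ u in Ioc (1 : ℝ) (2 ^ n), ‖gfun X δ u‖ ^ 2 :=
        setIntegral_mono_set ((integrableOn_norm_gfun_sq hX hδ le_rfl).mono_set Ioc_subset_Ioi_self)
          (Eventually.of_forall fun u ↦ by positivity) (Eventually.of_forall (Ioc_subset_Ioc_right hGn))
    _ = ∑ k ∈ Finset.range n, ∫ u in Ioc ((2 : ℝ) ^ k) (2 ^ (k + 1)), ‖gfun X δ u‖ ^ 2 :=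
        integral_Ioc_pow_two_eq_sum hX hδ n
    _ ≤ ∑ _k ∈ Finset.range n, Real.sqrt 2 * M := Finset.sum_le_sum hblocks
    _ = n * (Real.sqrt 2 * M) := by rw [Finset.sum_const, Finset.card_range, nsmul_eq_mul]
    _ ≤ (Real.log G / Real.log 2 + 1) * (Real.sqrt 2 * M) := by
        refine mul_le_mul_of_nonneg_right ?_ (by positivity)
        rw [Real.log_div_log]
        exact hn1.le

end Dyadic

/-! ## §2 The tail `∫_G^∞ |g|²/log² x` through finitely many `J(G, 2^{-k-2})` -/

section ThetaGrid

variable {X δ : ℝ}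

/-- **One-term lower bound**: for `4 ≤ y ≤ N`, `1/y² ≤ 4 ∑_{k<N} 2^{-2k-3} e^{-2^{-k-2} y}` (the term with
`2^{k+2} ≤ y < 2^{k+3}` alone is `≥ 2e^{-2}/y²`, and `8e^{-2} > 1`). [folklore] -/
theorem inv_sq_le_sum_exp {y : ℝ} (hy : 4 ≤ y) {N : ℕ} (hyN : y ≤ N) :
    1 / y ^ 2 ≤ 4 * ∑ k ∈ Finset.range N, (2 : ℝ) ^ (-(2 * (k : ℝ) + 3)) * Real.exp (-(2 : ℝ) ^ (-((k : ℝ) + 2)) * y) := by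
  obtain ⟨n, hn1, hn2⟩ := exists_nat_pow_near (by linarith : (1 : ℝ) ≤ y) one_lt_two
  -- `n ≥ 2`
  have hn2' : 2 ≤ n := by
    by_contra h
    push Not at h
    interval_cases n <;> norm_num at hn2 <;> linarith
  obtain ⟨k, rfl⟩ : ∃ k, n = k + 2 := ⟨n - 2, by omega⟩
  have hkN : k < N := by
    have h1 : ((k + 2 : ℕ) : ℝ) ≤ (2 : ℝ) ^ (k + 2) := by exact_mod_cast (Nat.lt_two_pow_self).le
    have : (k : ℝ) + 2 ≤ N := by push_cast at h1; linarith
    exact_mod_cast (by linarith : (k : ℝ) < N)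
  have hterm_nonneg : ∀ j ∈ Finset.range N, 0 ≤ (2 : ℝ) ^ (-(2 * (j : ℝ) + 3)) * Real.exp (-(2 : ℝ) ^ (-((j : ℝ) + 2)) * y) :=
    fun j _ ↦ by positivity
  have hsingle := Finset.single_le_sum hterm_nonneg (Finset.mem_range.mpr hkN)
  refine le_trans ?_ (mul_le_mul_of_nonneg_left hsingle (by norm_num))
  -- the chosen term: `2^{-(k+2)} y ∈ [1,2)`, `2^{-2k-3} = 2 (2^{-(k+2)})² ≥ 2/y²`
  have hpow : (2 : ℝ) ^ (-((k : ℝ) + 2)) = ((2 : ℝ) ^ (k + 2))⁻¹ := by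
    rw [Real.rpow_neg zero_le_two, ← Real.rpow_natCast]; push_cast; ring_nf
  have h2k : (0 : ℝ) < (2 : ℝ) ^ (k + 2) := by positivity
  have hz1 : 1 ≤ (2 : ℝ) ^ (-((k : ℝ) + 2)) * y := by
    rw [hpow, inv_mul_eq_div, one_le_div h2k]; exact hn1
  have hz2 : (2 : ℝ) ^ (-((k : ℝ) + 2)) * y ≤ 2 := by
    rw [hpow, inv_mul_eq_div, div_le_iff₀ h2k]
    rw [pow_succ] at hn2; linarith
  have hexp : Real.exp (-2) ≤ Real.exp (-(2 : ℝ) ^ (-((k : ℝ) + 2)) * y) := Real.exp_le_exp.mpr (by linarith)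
  have hcoef : 2 / y ^ 2 ≤ (2 : ℝ) ^ (-(2 * (k : ℝ) + 3)) := by
    have e : (2 : ℝ) ^ (-(2 * (k : ℝ) + 3)) = 2 * ((2 : ℝ) ^ (-((k : ℝ) + 2))) ^ 2 := by
      rw [← Real.rpow_natCast, ← Real.rpow_mul zero_le_two, show ((2 : ℕ) : ℝ) = 2 by norm_num,
        show (2 : ℝ) * (2 : ℝ) ^ (-((k : ℝ) + 2) * 2) = (2 : ℝ) ^ (1 : ℝ) * (2 : ℝ) ^ (-((k : ℝ) + 2) * 2) by
          rw [Real.rpow_one], ← Real.rpow_add two_pos]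
      ring_nf
    rw [e, div_le_iff₀ (by positivity)]
    have : 1 ≤ ((2 : ℝ) ^ (-((k : ℝ) + 2))) ^ 2 * y ^ 2 := by
      rw [← mul_pow]; nlinarith
    nlinarith
  have he2 : (1 : ℝ) ≤ 8 * Real.exp (-2) := by
    have h1 := Real.exp_one_lt_d9
    have hpos := Real.exp_pos (1 : ℝ)
    have h : Real.exp 2 = Real.exp 1 * Real.exp 1 := by rw [← Real.exp_add]; norm_num
    have hsq : Real.exp 1 * Real.exp 1 < 2.7182818286 * 2.7182818286 := mul_lt_mul'' h1 h1 hpos.le hpos.le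
    rw [Real.exp_neg, h, le_mul_inv_iff₀ (by positivity)]
    norm_num at hsq ⊢
    linarith
  have hy0 : 0 < y := by linarith
  calc 1 / y ^ 2 ≤ 8 * Real.exp (-2) / y ^ 2 := by gcongr
    _ = 4 * (2 / y ^ 2 * Real.exp (-2)) := by ring
    _ ≤ 4 * ((2 : ℝ) ^ (-(2 * (k : ℝ) + 3)) * Real.exp (-(2 : ℝ) ^ (-((k : ℝ) + 2)) * y)) := by
        gcongr

/-- **The tail on `[G, x₁]`**: `∫_{(G,x₁]} |g|²/log²x ≤ 4 ∑_{k<N} 2^{-2k-3} J(G, 2^{-k-2})` for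
`G ≥ 1`, `log G ≥ 4`, `log x₁ ≤ N`. [cite: Titchmarsh1986, §10.17] -/
theorem integral_tail_log_le_sum (hX : 0 < X) (hδ : 0 < Real.sin δ) {G x₁ : ℝ} (hG1 : 1 ≤ G) (hG : 4 ≤ Real.log G)
    {N : ℕ} (hN : Real.log x₁ ≤ N) :
    ∫ u in Ioc G x₁, ‖gfun X δ u‖ ^ 2 / Real.log u ^ 2 ≤
      4 * ∑ k ∈ Finset.range N, (2 : ℝ) ^ (-(2 * (k : ℝ) + 3)) * Jint X δ G ((2 : ℝ) ^ (-((k : ℝ) + 2))) := by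
  have hG0 : 0 < G := by linarith
  -- integrability of the pieces
  have hint : ∀ k : ℕ, IntegrableOn (fun u : ℝ ↦ ‖gfun X δ u‖ ^ 2 * u ^ (-(2 : ℝ) ^ (-((k : ℝ) + 2)))) (Ioi G) :=
    fun k ↦ integrableOn_norm_gfun_sq_rpow hX hδ (by positivity) hG1
  have hlhs_int : IntegrableOn (fun u : ℝ ↦ ‖gfun X δ u‖ ^ 2 / Real.log u ^ 2) (Ioc G x₁) := by
    refine Integrable.mono' ((integrableOn_norm_gfun_sq hX hδ hG1).mono_set Ioc_subset_Ioi_self) ?_ ?_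
    · refine ContinuousOn.aestronglyMeasurable ?_ measurableSet_Ioc
      refine (((continuousOn_gfun hX hδ).norm.pow 2).mono fun u hu ↦ hG1.trans (le_of_lt hu.1)).div
        ((Real.continuousOn_log.mono fun u hu ↦ ?_).pow 2) fun u hu ↦ ?_
      · exact ne_of_gt (hG0.trans hu.1)
      · have : 4 < Real.log u := lt_of_le_of_lt hG (Real.log_lt_log hG0 hu.1)
        positivity
    · refine (ae_restrict_iff' measurableSet_Ioc).mpr (Eventually.of_forall fun u hu ↦ ?_)
      have hlog : 4 < Real.log u := lt_of_le_of_lt hG (Real.log_lt_log hG0 hu.1)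
      rw [Real.norm_eq_abs, abs_of_nonneg (by positivity), div_eq_mul_inv]
      calc ‖gfun X δ u‖ ^ 2 * (Real.log u ^ 2)⁻¹ ≤ ‖gfun X δ u‖ ^ 2 * 1 := by
            refine mul_le_mul_of_nonneg_left (inv_le_one_of_one_le₀ ?_) (sq_nonneg _)
            nlinarith
        _ = _ := mul_one _
  calc ∫ u in Ioc G x₁, ‖gfun X δ u‖ ^ 2 / Real.log u ^ 2
      ≤ ∫ u in Ioc G x₁, 4 * ∑ k ∈ Finset.range N,
          (2 : ℝ) ^ (-(2 * (k : ℝ) + 3)) * (‖gfun X δ u‖ ^ 2 * u ^ (-(2 : ℝ) ^ (-((k : ℝ) + 2)))) := by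
        refine setIntegral_mono_on hlhs_int ?_ measurableSet_Ioc fun u hu ↦ ?_
        · refine Integrable.const_mul (integrable_finsetSum _ fun k _ ↦ ((hint k).mono_set Ioc_subset_Ioi_self).const_mul _) _
        · have hu0 : 0 < u := hG0.trans hu.1
          have hlog : 4 ≤ Real.log u := hG.trans (Real.log_le_log hG0 hu.1.le)
          have hlogN : Real.log u ≤ N := (Real.log_le_log hu0 hu.2).trans hN
          have key := inv_sq_le_sum_exp hlog hlogN
          rw [div_eq_mul_one_div]
          calc ‖gfun X δ u‖ ^ 2 * (1 / Real.log u ^ 2)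
              ≤ ‖gfun X δ u‖ ^ 2 * (4 * ∑ k ∈ Finset.range N,
                  (2 : ℝ) ^ (-(2 * (k : ℝ) + 3)) * Real.exp (-(2 : ℝ) ^ (-((k : ℝ) + 2)) * Real.log u)) :=
                mul_le_mul_of_nonneg_left key (sq_nonneg _)
            _ = _ := by
                rw [Finset.mul_sum, Finset.mul_sum, Finset.mul_sum]
                refine Finset.sum_congr rfl fun k _ ↦ ?_
                rw [Real.rpow_def_of_pos hu0]
                ring_nf
    _ = 4 * ∑ k ∈ Finset.range N, (2 : ℝ) ^ (-(2 * (k : ℝ) + 3)) *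
          ∫ u in Ioc G x₁, ‖gfun X δ u‖ ^ 2 * u ^ (-(2 : ℝ) ^ (-((k : ℝ) + 2))) := by
        rw [integral_const_mul, integral_finsetSum _ fun k _ ↦ ((hint k).mono_set Ioc_subset_Ioi_self).const_mul _]
        congr 1
        exact Finset.sum_congr rfl fun k _ ↦ integral_const_mul _ _
    _ ≤ 4 * ∑ k ∈ Finset.range N, (2 : ℝ) ^ (-(2 * (k : ℝ) + 3)) * Jint X δ G ((2 : ℝ) ^ (-((k : ℝ) + 2))) := by
        gcongr with k hk
        rw [Jint]
        exact setIntegral_mono_set (hint k) ((ae_restrict_iff' measurableSet_Ioi).mpr (Eventually.of_forall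
          fun u hu ↦ by have : 0 ≤ u := le_of_lt (lt_trans hG0 hu); positivity))
          (Eventually.of_forall Ioc_subset_Ioi_self)

/-- **The geometric–exponential sum**: `∑_{k<N} 2^{-k-1} e^{-L₀ 2^{-k-2}} ≤ 18/L₀` (`L₀ ≥ 1`). [folklore] -/
theorem sum_geom_exp_le {L₀ : ℝ} (hL : 1 ≤ L₀) (N : ℕ) :
    ∑ k ∈ Finset.range N, (2 : ℝ) ^ (-((k : ℝ) + 1)) * Real.exp (-L₀ * (2 : ℝ) ^ (-((k : ℝ) + 2))) ≤ 18 / L₀ := by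
  have hL0 : 0 < L₀ := by linarith
  obtain ⟨k₀, hk₀1, hk₀2⟩ := exists_nat_pow_near hL one_lt_two
  -- termwise bounds
  have hA : ∀ k : ℕ, (2 : ℝ) ^ (-((k : ℝ) + 1)) * Real.exp (-L₀ * (2 : ℝ) ^ (-((k : ℝ) + 2))) ≤ (2 : ℝ) ^ (-((k : ℝ) + 1)) := by
    intro k
    have : Real.exp (-L₀ * (2 : ℝ) ^ (-((k : ℝ) + 2))) ≤ 1 := Real.exp_le_one_iff.mpr (by
      have := Real.rpow_pos_of_pos two_pos (-((k : ℝ) + 2)); nlinarith)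
    calc _ ≤ (2 : ℝ) ^ (-((k : ℝ) + 1)) * 1 := mul_le_mul_of_nonneg_left this (by positivity)
      _ = _ := mul_one _
  have hB : ∀ k : ℕ, (2 : ℝ) ^ (-((k : ℝ) + 1)) * Real.exp (-L₀ * (2 : ℝ) ^ (-((k : ℝ) + 2))) ≤ 16 * (2 : ℝ) ^ k / L₀ ^ 2 := by
    intro k
    set t : ℝ := (2 : ℝ) ^ (-((k : ℝ) + 2)) with ht
    have ht0 : 0 < t := Real.rpow_pos_of_pos two_pos _
    have htinv : t⁻¹ = 4 * (2 : ℝ) ^ k := by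
      rw [ht, ← Real.rpow_neg zero_le_two, neg_neg, Real.rpow_add two_pos, Real.rpow_natCast]
      norm_num; ring
    have h2k : (2 : ℝ) ^ (-((k : ℝ) + 1)) = 2 * t := by
      rw [ht, show -((k : ℝ) + 1) = 1 + -((k : ℝ) + 2) by ring, Real.rpow_add two_pos, Real.rpow_one]
    set y : ℝ := L₀ * t with hy
    have hy0 : 0 < y := by positivity
    -- `e^{-y} ≤ 2/y²` (from `y²/2 ≤ e^y`)
    have hexp : Real.exp (-y) ≤ 2 / y ^ 2 := by
      have h := Real.pow_div_factorial_le_exp y hy0.le (n := 2)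
      simp only [Nat.factorial, Nat.succ_eq_add_one, Nat.reduceAdd, Nat.cast_ofNat, mul_one] at h
      rw [Real.exp_neg, inv_eq_one_div, div_le_div_iff₀ (Real.exp_pos y) (by positivity)]
      norm_num at h ⊢
      linarith
    calc (2 : ℝ) ^ (-((k : ℝ) + 1)) * Real.exp (-L₀ * t)
        = 2 * t * Real.exp (-y) := by rw [h2k, hy]; ring_nf
      _ ≤ 2 * t * (2 / y ^ 2) := mul_le_mul_of_nonneg_left hexp (by positivity)
      _ = 4 * t⁻¹ / L₀ ^ 2 := by rw [hy]; field_simp; ring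
      _ = 16 * (2 : ℝ) ^ k / L₀ ^ 2 := by rw [htinv]; ring
  -- split the range at `k₀`
  rw [← Finset.sum_filter_add_sum_filter_not (Finset.range N) (fun k ↦ k < k₀)]
  have hpart1 : ∑ k ∈ (Finset.range N).filter (fun k ↦ k < k₀),
      (2 : ℝ) ^ (-((k : ℝ) + 1)) * Real.exp (-L₀ * (2 : ℝ) ^ (-((k : ℝ) + 2))) ≤ 16 / L₀ := by
    calc _ ≤ ∑ k ∈ (Finset.range N).filter (fun k ↦ k < k₀), 16 * (2 : ℝ) ^ k / L₀ ^ 2 :=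
          Finset.sum_le_sum fun k _ ↦ hB k
      _ ≤ ∑ k ∈ Finset.range k₀, 16 * (2 : ℝ) ^ k / L₀ ^ 2 := by
          refine Finset.sum_le_sum_of_subset_of_nonneg (fun k hk ↦ ?_) fun k _ _ ↦ by positivity
          simp only [Finset.mem_filter, Finset.mem_range] at hk ⊢
          exact hk.2
      _ = 16 / L₀ ^ 2 * ∑ k ∈ Finset.range k₀, (2 : ℝ) ^ k := by rw [Finset.mul_sum]; exact Finset.sum_congr rfl fun k _ ↦ by ring
      _ ≤ 16 / L₀ ^ 2 * (2 : ℝ) ^ k₀ := by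
          refine mul_le_mul_of_nonneg_left ?_ (by positivity)
          have := geom_sum_eq (x := (2 : ℝ)) (by norm_num) k₀
          rw [this]; norm_num
      _ ≤ 16 / L₀ ^ 2 * L₀ := mul_le_mul_of_nonneg_left hk₀1 (by positivity)
      _ = 16 / L₀ := by field_simp
  have hpart2 : ∑ k ∈ (Finset.range N).filter (fun k ↦ ¬k < k₀),
      (2 : ℝ) ^ (-((k : ℝ) + 1)) * Real.exp (-L₀ * (2 : ℝ) ^ (-((k : ℝ) + 2))) ≤ 2 / L₀ := by
    calc _ ≤ ∑ k ∈ (Finset.range N).filter (fun k ↦ ¬k < k₀), (2 : ℝ) ^ (-((k : ℝ) + 1)) :=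
          Finset.sum_le_sum fun k _ ↦ hA k
      _ ≤ ∑ k ∈ Finset.Ico k₀ (max N k₀), (2 : ℝ) ^ (-((k : ℝ) + 1)) := by
          refine Finset.sum_le_sum_of_subset_of_nonneg (fun k hk ↦ ?_) fun k _ _ ↦ by positivity
          simp only [Finset.mem_filter, Finset.mem_range, not_lt] at hk
          simp only [Finset.mem_Ico]
          exact ⟨hk.2, lt_of_lt_of_le hk.1 (le_max_left _ _)⟩
      _ = ∑ j ∈ Finset.range (max N k₀ - k₀), (2 : ℝ) ^ (-(((j + k₀ : ℕ) : ℝ) + 1)) := by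
          rw [Finset.sum_Ico_eq_sum_range]
          refine Finset.sum_congr rfl fun j _ ↦ ?_
          push_cast; ring_nf
      _ = (2 : ℝ) ^ (-((k₀ : ℝ) + 1)) * ∑ j ∈ Finset.range (max N k₀ - k₀), (1 / 2 : ℝ) ^ j := by
          rw [Finset.mul_sum]
          refine Finset.sum_congr rfl fun j _ ↦ ?_
          rw [one_div, inv_pow, ← Real.rpow_natCast 2 j, ← Real.rpow_neg zero_le_two, ← Real.rpow_add two_pos]
          push_cast; ring_nf
      _ ≤ (2 : ℝ) ^ (-((k₀ : ℝ) + 1)) * 2 :=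
          mul_le_mul_of_nonneg_left (sum_geometric_two_le _) (by positivity)
      _ = ((2 : ℝ) ^ k₀)⁻¹ := by
          rw [Real.rpow_neg zero_le_two, Real.rpow_add two_pos, Real.rpow_natCast, Real.rpow_one]
          field_simp
      _ ≤ 2 / L₀ := by
          rw [inv_eq_one_div, div_le_div_iff₀ (by positivity) hL0]
          rw [pow_succ] at hk₀2
          linarith
  calc _ ≤ 16 / L₀ + 2 / L₀ := add_le_add hpart1 hpart2
    _ = 18 / L₀ := by ring

end ThetaGrid

/-! ## §3 The `v`-side: splitting `∫_0^∞ |f̃ k_h|²` at `v = 4/h` -/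

section VSide

variable {X δ : ℝ}

/-- `∫_{(V,∞)} e^{-v/2}/v² ≤ 2/V²` (`V > 0`). [folklore] -/
theorem integral_exp_neg_half_div_sq_le {V : ℝ} (hV : 0 < V) :
    IntegrableOn (fun v : ℝ ↦ Real.exp (-(1 / 2) * v) / v ^ 2) (Ioi V) ∧
      ∫ v in Ioi V, Real.exp (-(1 / 2) * v) / v ^ 2 ≤ 2 / V ^ 2 := by
  have hexp : IntegrableOn (fun v : ℝ ↦ Real.exp (-(1 / 2) * v)) (Ioi V) := integrableOn_exp_mul_Ioi (by norm_num) V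
  have hmaj : IntegrableOn (fun v : ℝ ↦ (V ^ 2)⁻¹ * Real.exp (-(1 / 2) * v)) (Ioi V) := hexp.const_mul _
  have hle : ∀ v ∈ Ioi V, Real.exp (-(1 / 2) * v) / v ^ 2 ≤ (V ^ 2)⁻¹ * Real.exp (-(1 / 2) * v) := by
    intro v hv
    rw [div_eq_inv_mul]
    refine mul_le_mul_of_nonneg_right (inv_anti₀ (by positivity) ?_) (Real.exp_pos _).le
    exact pow_le_pow_left₀ hV.le (le_of_lt hv) 2
  have hint : IntegrableOn (fun v : ℝ ↦ Real.exp (-(1 / 2) * v) / v ^ 2) (Ioi V) := by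
    refine Integrable.mono' hmaj ?_ ?_
    · refine ContinuousOn.aestronglyMeasurable ?_ measurableSet_Ioi
      refine ContinuousOn.div (by fun_prop) (by fun_prop) fun v hv ↦ ?_
      have : 0 < v := hV.trans hv
      positivity
    · refine (ae_restrict_iff' measurableSet_Ioi).mpr (Eventually.of_forall fun v hv ↦ ?_)
      rw [Real.norm_eq_abs, abs_of_nonneg (by positivity)]
      exact hle v hv
  refine ⟨hint, ?_⟩
  calc ∫ v in Ioi V, Real.exp (-(1 / 2) * v) / v ^ 2 ≤ ∫ v in Ioi V, (V ^ 2)⁻¹ * Real.exp (-(1 / 2) * v) :=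
        setIntegral_mono_on hint hmaj measurableSet_Ioi hle
    _ = (V ^ 2)⁻¹ * (2 * Real.exp (-(1 / 2) * V)) := by
        rw [integral_const_mul, integral_exp_mul_Ioi (by norm_num)]; ring
    _ ≤ (V ^ 2)⁻¹ * (2 * 1) := by
        gcongr
        exact Real.exp_le_one_iff.mpr (by nlinarith)
    _ = 2 / V ^ 2 := by ring

/-- **The `v`-side estimate**: for `h > 0`, `V = 4/h`, `G = e^{V/2}`,
`∫_0^∞ |f̃ k_h|² ≤ 16h² ∫_1^G |g|² + 8h²P₀² + 64 ∫_G^∞ |g|²/log²x`.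
[cite: Titchmarsh1986, §10.17] -/
theorem integral_Ioi_ftil_kWin_le (hδ : 0 < δ) (hδ1 : δ ≤ 1) (hX : 0 < X) {h : ℝ} (hh : 0 < h) :
    ∫ v in Ioi (0 : ℝ), ‖ftil X δ v * kWin h v‖ ^ 2 ≤
      16 * h ^ 2 * (∫ x in Ioc 1 (Real.exp (4 / h / 2)), ‖gfun X δ x‖ ^ 2) + 8 * h ^ 2 * phiProd X ^ 2 +
        64 * ∫ x in Ioi (Real.exp (4 / h / 2)), ‖gfun X δ x‖ ^ 2 / Real.log x ^ 2 := by
  obtain ⟨hsin, _⟩ := sin_cos_bounds hδ hδ1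
  have hs0 : 0 < Real.sin δ := by linarith
  set V : ℝ := 4 / h with hV
  have hV0 : 0 < V := by positivity
  set G : ℝ := Real.exp (V / 2) with hG
  have hG1 : 1 < G := by rw [hG, ← Real.exp_zero]; exact Real.exp_lt_exp.mpr (by positivity)
  -- integrability of `|f̃ k_h|²`
  obtain ⟨hi, h2⟩ := integrable_memLp_ftil_mul_kWin hδ hδ1 hh X
  have hF : Integrable (fun v : ℝ ↦ ‖ftil X δ v * kWin h v‖ ^ 2) := (memLp_two_iff_integrable_sq_norm h2.1).mp h2
  -- the majorant pieces
  have hsub0 := integral_exp_half_subst (fun x : ℝ ↦ ‖gfun X δ x‖ ^ 2) 0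
  rw [zero_div, Real.exp_zero] at hsub0
  have hsubV := integral_exp_half_subst (fun x : ℝ ↦ ‖gfun X δ x‖ ^ 2) V
  have hsubV' := integral_exp_half_subst (fun x : ℝ ↦ ‖gfun X δ x‖ ^ 2 / Real.log x ^ 2) V
  have hg0 : IntegrableOn (fun v : ℝ ↦ Real.exp (v / 2) * ‖gfun X δ (Real.exp (v / 2))‖ ^ 2) (Ioi 0) :=
    hsub0.1.mp (integrableOn_norm_gfun_sq hX hs0 le_rfl)
  have hgV : IntegrableOn (fun v : ℝ ↦ Real.exp (v / 2) * ‖gfun X δ (Real.exp (v / 2))‖ ^ 2) (Ioi V) :=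
    hsubV.1.mp (integrableOn_norm_gfun_sq hX hs0 hG1.le)
  -- `|g|²/log²x` on `(G,∞)`: integrable (bounded by `|g|²/log²G`)
  have hlogG : Real.log G = V / 2 := by rw [hG, Real.log_exp]
  have hglog : IntegrableOn (fun x : ℝ ↦ ‖gfun X δ x‖ ^ 2 / Real.log x ^ 2) (Ioi G) := by
    refine Integrable.mono' ((integrableOn_norm_gfun_sq hX hs0 hG1.le).const_mul ((Real.log G) ^ 2)⁻¹) ?_ ?_
    · refine ContinuousOn.aestronglyMeasurable ?_ measurableSet_Ioi
      refine (((continuousOn_gfun hX hs0).norm.pow 2).mono fun u hu ↦ hG1.le.trans (le_of_lt hu)).div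
        ((Real.continuousOn_log.mono fun u hu ↦ ?_).pow 2) fun u hu ↦ ?_
      · exact ne_of_gt (lt_trans (by linarith) hu)
      · have : 0 < Real.log u := by rw [← Real.log_one]; exact Real.log_lt_log one_pos (hG1.trans hu)
        positivity
    · refine (ae_restrict_iff' measurableSet_Ioi).mpr (Eventually.of_forall fun u hu ↦ ?_)
      have hlogu : Real.log G ≤ Real.log u := Real.log_le_log (by linarith) (le_of_lt hu)
      have hlogG0 : 0 < Real.log G := by rw [hlogG]; positivity
      rw [Real.norm_eq_abs, abs_of_nonneg (by positivity), div_eq_mul_inv, mul_comm (((Real.log G) ^ 2)⁻¹)]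
      exact mul_le_mul_of_nonneg_left (inv_anti₀ (by positivity) (pow_le_pow_left₀ hlogG0.le hlogu 2)) (sq_nonneg _)
  have hgV' : IntegrableOn (fun v : ℝ ↦ Real.exp (v / 2) * (‖gfun X δ (Real.exp (v / 2))‖ ^ 2 / Real.log (Real.exp (v / 2)) ^ 2))
      (Ioi V) := hsubV'.1.mp (by rw [← hG]; exact hglog)
  have hexp0 : IntegrableOn (fun v : ℝ ↦ Real.exp (-(1 / 2) * v)) (Ioi 0) := integrableOn_exp_mul_Ioi (by norm_num) 0
  obtain ⟨hexpV, hexpVle⟩ := integral_exp_neg_half_div_sq_le hV0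
  -- split `(0,∞) = (0,V] ∪ (V,∞)`
  have hsplit : ∫ v in Ioi (0 : ℝ), ‖ftil X δ v * kWin h v‖ ^ 2 =
      (∫ v in Ioc 0 V, ‖ftil X δ v * kWin h v‖ ^ 2) + ∫ v in Ioi V, ‖ftil X δ v * kWin h v‖ ^ 2 := by
    have hdisj : Disjoint (Ioc (0 : ℝ) V) (Ioi V) := Set.disjoint_left.mpr fun u hu hu' ↦ (not_lt.mpr hu.2) hu'
    rw [← Ioc_union_Ioi_eq_Ioi hV0.le, setIntegral_union hdisj measurableSet_Ioi (hF.integrableOn) (hF.integrableOn)]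
  -- (i) on `(0,V]`: `|k_h| ≤ h`
  have hpt : ∀ v : ℝ, ‖ftil X δ v‖ ^ 2 ≤ 8 * (Real.exp (v / 2) * ‖gfun X δ (Real.exp (v / 2))‖ ^ 2) +
      2 * phiProd X ^ 2 * Real.exp (-(1 / 2) * v) := by
    intro v
    have := norm_sq_ftil_le hδ hδ1 X v
    calc ‖ftil X δ v‖ ^ 2 ≤ 8 * Real.exp (v / 2) * ‖gfun X δ (Real.exp (v / 2))‖ ^ 2 +
          2 * Real.exp (-(v / 2)) * phiProd X ^ 2 := this
      _ = _ := by rw [show -(v / 2) = -(1 / 2) * v by ring]; ring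
  have hI : ∫ v in Ioc 0 V, ‖ftil X δ v * kWin h v‖ ^ 2 ≤
      h ^ 2 * (8 * (2 * ∫ x in Ioc 1 G, ‖gfun X δ x‖ ^ 2) + 2 * phiProd X ^ 2 * 2) := by
    have hmajI : IntegrableOn (fun v : ℝ ↦ h ^ 2 * (8 * (Real.exp (v / 2) * ‖gfun X δ (Real.exp (v / 2))‖ ^ 2) +
        2 * phiProd X ^ 2 * Real.exp (-(1 / 2) * v))) (Ioc 0 V) :=
      (((hg0.mono_set Ioc_subset_Ioi_self).const_mul 8).add ((hexp0.mono_set Ioc_subset_Ioi_self).const_mul _)).const_mul _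
    calc ∫ v in Ioc 0 V, ‖ftil X δ v * kWin h v‖ ^ 2
        ≤ ∫ v in Ioc 0 V, h ^ 2 * (8 * (Real.exp (v / 2) * ‖gfun X δ (Real.exp (v / 2))‖ ^ 2) +
            2 * phiProd X ^ 2 * Real.exp (-(1 / 2) * v)) := by
          refine setIntegral_mono_on hF.integrableOn hmajI measurableSet_Ioc fun v _ ↦ ?_
          rw [norm_mul, mul_pow]
          calc ‖ftil X δ v‖ ^ 2 * ‖kWin h v‖ ^ 2 ≤ ‖ftil X δ v‖ ^ 2 * h ^ 2 :=
                mul_le_mul_of_nonneg_left (pow_le_pow_left₀ (norm_nonneg _) (norm_kWin_le hh.le v) 2) (sq_nonneg _)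
            _ ≤ _ := by rw [mul_comm]; exact mul_le_mul_of_nonneg_left (hpt v) (sq_nonneg _)
      _ = h ^ 2 * (8 * (∫ v in Ioc 0 V, Real.exp (v / 2) * ‖gfun X δ (Real.exp (v / 2))‖ ^ 2) +
            2 * phiProd X ^ 2 * ∫ v in Ioc 0 V, Real.exp (-(1 / 2) * v)) := by
          rw [integral_const_mul, integral_add ((hg0.mono_set Ioc_subset_Ioi_self).const_mul 8)
            ((hexp0.mono_set Ioc_subset_Ioi_self).const_mul _), integral_const_mul, integral_const_mul]
      _ ≤ _ := by
          gcongr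
          · -- `∫_{(0,V]} e^{v/2}|g(e^{v/2})|² = 2∫_{(1,G]} |g|²`
            have e1 : ∫ v in Ioc 0 V, Real.exp (v / 2) * ‖gfun X δ (Real.exp (v / 2))‖ ^ 2 =
                (∫ v in Ioi 0, Real.exp (v / 2) * ‖gfun X δ (Real.exp (v / 2))‖ ^ 2) -
                  ∫ v in Ioi V, Real.exp (v / 2) * ‖gfun X δ (Real.exp (v / 2))‖ ^ 2 := by
              have hdisj : Disjoint (Ioc (0 : ℝ) V) (Ioi V) := Set.disjoint_left.mpr fun u hu hu' ↦ (not_lt.mpr hu.2) hu'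
              rw [← Ioc_union_Ioi_eq_Ioi hV0.le, setIntegral_union hdisj measurableSet_Ioi
                (hg0.mono_set Ioc_subset_Ioi_self) hgV]
              ring
            have e2 : ∫ x in Ioc 1 G, ‖gfun X δ x‖ ^ 2 =
                (∫ x in Ioi 1, ‖gfun X δ x‖ ^ 2) - ∫ x in Ioi G, ‖gfun X δ x‖ ^ 2 := by
              have hdisj : Disjoint (Ioc (1 : ℝ) G) (Ioi G) := Set.disjoint_left.mpr fun u hu hu' ↦ (not_lt.mpr hu.2) hu'
              rw [← Ioc_union_Ioi_eq_Ioi hG1.le, setIntegral_union hdisj measurableSet_Ioi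
                ((integrableOn_norm_gfun_sq hX hs0 le_rfl).mono_set Ioc_subset_Ioi_self)
                (integrableOn_norm_gfun_sq hX hs0 hG1.le)]
              ring
            rw [e1, e2, hsub0.2, hsubV.2, ← hG]
            linarith
          · calc ∫ v in Ioc 0 V, Real.exp (-(1 / 2) * v) ≤ ∫ v in Ioi 0, Real.exp (-(1 / 2) * v) :=
                  setIntegral_mono_set hexp0 (Eventually.of_forall fun v ↦ (Real.exp_pos _).le)
                    (Eventually.of_forall Ioc_subset_Ioi_self)
              _ = 2 := by rw [integral_exp_mul_Ioi (by norm_num)]; norm_num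
  -- (ii) on `(V,∞)`: `|k_h| ≤ 4/v`
  have hII : ∫ v in Ioi V, ‖ftil X δ v * kWin h v‖ ^ 2 ≤
      16 * (2 * (2 * ∫ x in Ioi G, ‖gfun X δ x‖ ^ 2 / Real.log x ^ 2) + 2 * phiProd X ^ 2 * (2 / V ^ 2)) := by
    have hmajII : IntegrableOn (fun v : ℝ ↦ 16 * (2 * (Real.exp (v / 2) *
        (‖gfun X δ (Real.exp (v / 2))‖ ^ 2 / Real.log (Real.exp (v / 2)) ^ 2)) +
          2 * phiProd X ^ 2 * (Real.exp (-(1 / 2) * v) / v ^ 2))) (Ioi V) :=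
      ((hgV'.const_mul 2).add (hexpV.const_mul _)).const_mul _
    calc ∫ v in Ioi V, ‖ftil X δ v * kWin h v‖ ^ 2
        ≤ ∫ v in Ioi V, 16 * (2 * (Real.exp (v / 2) * (‖gfun X δ (Real.exp (v / 2))‖ ^ 2 / Real.log (Real.exp (v / 2)) ^ 2)) +
            2 * phiProd X ^ 2 * (Real.exp (-(1 / 2) * v) / v ^ 2)) := by
          refine setIntegral_mono_on hF.integrableOn hmajII measurableSet_Ioi fun v hv ↦ ?_
          have hv0 : 0 < v := hV0.trans hv
          have hk : ‖kWin h v‖ ^ 2 ≤ 16 / v ^ 2 := by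
            calc ‖kWin h v‖ ^ 2 ≤ (4 / |v|) ^ 2 := pow_le_pow_left₀ (norm_nonneg _) (norm_kWin_le_div h hv0.ne') 2
              _ = 16 / v ^ 2 := by rw [div_pow, sq_abs]; norm_num
          rw [norm_mul, mul_pow, Real.log_exp]
          calc ‖ftil X δ v‖ ^ 2 * ‖kWin h v‖ ^ 2 ≤ (8 * (Real.exp (v / 2) * ‖gfun X δ (Real.exp (v / 2))‖ ^ 2) +
                2 * phiProd X ^ 2 * Real.exp (-(1 / 2) * v)) * (16 / v ^ 2) :=
                mul_le_mul (hpt v) hk (sq_nonneg _) (by positivity)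
            _ = _ := by field_simp; ring
      _ = 16 * (2 * (∫ v in Ioi V, Real.exp (v / 2) * (‖gfun X δ (Real.exp (v / 2))‖ ^ 2 / Real.log (Real.exp (v / 2)) ^ 2)) +
            2 * phiProd X ^ 2 * ∫ v in Ioi V, Real.exp (-(1 / 2) * v) / v ^ 2) := by
          rw [integral_const_mul, integral_add (hgV'.const_mul 2) (hexpV.const_mul _), integral_const_mul, integral_const_mul]
      _ ≤ _ := by
          gcongr
          · rw [hsubV'.2, ← hG]
  -- combine
  rw [hsplit]
  have hVh : 2 / V ^ 2 = h ^ 2 / 8 := by rw [hV]; field_simp; ring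
  rw [hVh] at hII
  nlinarith [hI, hII, sq_nonneg h, sq_nonneg (phiProd X)]

end VSide

/-! ## §4 Lemma 10.17 -/

set_option maxHeartbeats 1600000 in
/-- **Titchmarsh's Lemma 10.17** (discharge of the named fact `Titchmarsh1986_lemma_10_17`):
`∫_{-∞}^∞ |∫_t^{t+H} F(u) du|² dt = O(H/(δ^{1/2} log X))` for `X = δ^{-c}`, `H = (a log X)^{-1}`,
`0 < c < ⅛`, `(a+2)c ≤ ¼`, `δ ≤ δ₀(a,c)`, with a constant depending on `c` only.
[cite: Titchmarsh1986, §10.17, Lemma 10.17] -/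
theorem Titchmarsh1986_lemma_10_17_holds : Titchmarsh1986_lemma_10_17 := by
  intro c hc hc8
  obtain ⟨K, C₂, hK, hC₂, hJ⟩ := Jint_le
  refine ⟨2 * π * (128 * Real.sqrt 2 * K + 2304 * K + 2), fun a ha hac ↦ ?_⟩
  -- exponents: `e = 2ac`, `2c + e < ½`
  have hac' : a * c ≤ 1 / 4 - 2 * c := by nlinarith
  have hce : 2 * c + 2 * (a * c) < 1 / 2 := by nlinarith
  obtain ⟨dJ, hdJ, HJ⟩ := jint_side_conditions C₂ hc (by linarith) hce
  obtain ⟨dT, hdT, HT⟩ := gaussTail_le_one hc hc8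
  obtain ⟨dP, hdP, _, HP⟩ := exists_delta0_log (64 * π * (1 + c) ^ 2 / a) (by linarith : 0 < 1 / 2 - 2 * c) 2
  obtain ⟨dR, hdR, _, HR⟩ := exists_delta0_log (128 * π * a * c ^ 2) (by norm_num : (0 : ℝ) < 1 / 2) 2
  -- `H ≤ ½`: `δ ≤ exp(-2/(ac))`
  set dH : ℝ := Real.exp (-(2 / (a * c))) with hdH
  set d₆ : ℝ := min (Real.exp (-2)) ((3 : ℝ) ^ (-(1 / c))) with hd₆
  refine ⟨min (min (min dJ dT) (min dP dR)) (min dH d₆), by positivity, fun δ hδ hδle ↦ ?_⟩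
  have hδJ : δ ≤ dJ := hδle.trans ((min_le_left _ _).trans ((min_le_left _ _).trans (min_le_left _ _)))
  have hδT : δ ≤ dT := hδle.trans ((min_le_left _ _).trans ((min_le_left _ _).trans (min_le_right _ _)))
  have hδP : δ ≤ dP := hδle.trans ((min_le_left _ _).trans ((min_le_right _ _).trans (min_le_left _ _)))
  have hδR : δ ≤ dR := hδle.trans ((min_le_left _ _).trans ((min_le_right _ _).trans (min_le_right _ _)))
  have hδH : δ ≤ dH := hδle.trans ((min_le_right _ _).trans (min_le_left _ _))
  have hδe2 : δ ≤ Real.exp (-2) := hδle.trans ((min_le_right _ _).trans ((min_le_right _ _).trans (min_le_left _ _)))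
  have hδ3c : δ ≤ (3 : ℝ) ^ (-(1 / c)) := hδle.trans ((min_le_right _ _).trans ((min_le_right _ _).trans (min_le_right _ _)))
  obtain ⟨hL2, hX3, hδ1⟩ := regime_basic hc hδ hδe2 hδ3c
  obtain ⟨hlogX, hX0, hXpow⟩ := rpow_neg_facts (c := c) hδ
  set X : ℝ := δ ^ (-c) with hXdef
  set L : ℝ := Real.log (1 / δ) with hL
  have hL0 : 0 < L := by linarith
  have hX1 : 1 ≤ X := by linarith
  set Lx : ℝ := Real.log X with hLxdef
  have hLx : Lx = c * L := hlogX
  have hLx0 : 0 < Lx := by rw [hLx]; positivity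
  have hlogX1 : 1 + Lx ≤ (1 + c) * L := by rw [hLx]; nlinarith
  have hsδ : 0 < Real.sqrt δ := Real.sqrt_pos.mpr hδ
  have hsδ1 : Real.sqrt δ ≤ 1 := Real.sqrt_le_one.mpr hδ1.le
  have hsqδ : Real.sqrt δ = δ ^ (1 / 2 : ℝ) := Real.sqrt_eq_rpow δ
  obtain ⟨hsin, _⟩ := sin_cos_bounds hδ hδ1.le
  have hs0 : 0 < Real.sin δ := by linarith
  -- `H = 1/(a log X)`, `V = 4/H`, `G = e^{V/2} = e^{2/H} = δ^{-2ac}`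
  set H : ℝ := 1 / (a * Lx) with hH
  have hH0 : 0 < H := by positivity
  have hHL : H = 1 / (a * c * L) := by rw [hH, hLx]; ring
  -- `H ≤ ½` from `L ≥ 2/(ac)`
  have hLac : 2 / (a * c) ≤ L := by
    rw [hL, one_div, Real.log_inv, le_neg]
    have := Real.log_le_log hδ hδH
    rwa [hdH, Real.log_exp] at this
  have hH12 : H ≤ 1 / 2 := by
    rw [hHL, div_le_iff₀ (by positivity)]
    rw [div_le_iff₀ (by positivity)] at hLac
    linarith
  have hH1 : H ≤ 1 := by linarith
  set G : ℝ := Real.exp (4 / H / 2) with hG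
  have hG4H : 4 / H / 2 = 2 * (a * c) * L := by rw [hHL]; field_simp; ring
  have hGrpow : G = δ ^ (-(2 * (a * c))) := by
    rw [hG, hG4H, Real.rpow_def_of_pos hδ, hL, one_div, Real.log_inv]; ring_nf
  have hlogG : Real.log G = 2 / H := by rw [hG, Real.log_exp]; ring
  have hlogG4 : 4 ≤ Real.log G := by
    rw [hlogG, le_div_iff₀ hH0]; linarith
  have hG1 : 1 < G := by rw [hG, ← Real.exp_zero]; exact Real.exp_lt_exp.mpr (by positivity)
  set x₁ : ℝ := δ ^ (-(2 : ℝ)) with hx₁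
  have hx₁1 : 1 ≤ x₁ := Real.one_le_rpow_of_pos_of_le_one_of_nonpos hδ hδ1.le (by norm_num)
  have hGx₁ : G ≤ x₁ := by
    rw [hGrpow, hx₁]
    exact Real.rpow_le_rpow_of_exponent_ge hδ hδ1.le (by nlinarith)
  have hlogx₁ : Real.log x₁ = 2 * L := by
    rw [hx₁, Real.log_rpow hδ, hL, one_div, Real.log_inv]; ring
  -- `D = 1/(√δ log X)`
  set D : ℝ := 1 / (Real.sqrt δ * Lx) with hD
  have hD0 : 0 < D := by positivity
  have hHD : H * D = 1 / (a * c ^ 2 * L ^ 2 * Real.sqrt δ) := by rw [hH, hD, hLx]; field_simp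
  -- the window Parseval
  obtain ⟨hWint, hWeq⟩ := integral_selbergWindow_sq_eq hδ hδ1.le hH0 X
  refine ⟨hWint, ?_⟩
  show ∫ t : ℝ, selbergWindow X δ H t ^ 2 ≤ 2 * π * (128 * Real.sqrt 2 * K + 2304 * K + 2) * H / (Real.sqrt δ * Lx)
  rw [hWeq, integral_norm_sq_ftil_mul_kWin_eq hδ hδ1.le hH0.le]
  have hTv := integral_Ioi_ftil_kWin_le hδ hδ1.le hX0 hH0 (X := X)
  -- `J`-bounds: at `x < G`, `θ = ½`; at `x = G`, `θ = 2^{-k-2}`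
  have hside : ∀ x : ℝ, 1 ≤ x → x ≤ G →
      x * X ^ 2 * Real.sqrt (2 * π * δ) ≤ 1 ∧ 24 * x * X ^ 2 * (1 + Real.log X) ^ 3 * Real.sqrt δ ≤ 1 ∧
        C₂ * X ^ 4 * (1 + Real.log X + Real.log (1 / δ)) ^ 4 * Real.sqrt δ ≤ 1 :=
    fun x hx hxG ↦ HJ δ hδ hδJ x hx (hGrpow ▸ hxG)
  have hJhalf : ∀ x : ℝ, 1 ≤ x → x < G → Jint X δ x (1 / 2) ≤ 2 * K * D / Real.sqrt x := by
    intro x hx hxG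
    obtain ⟨c1, c2, c3⟩ := hside x hx hxG.le
    have h := hJ X hX3 δ hδ hδ1.le (1 / 2) (by norm_num) le_rfl x hx c1 c2 c3
    rw [← hLxdef] at h
    refine h.trans (le_of_eq ?_)
    rw [hD, ← Real.sqrt_eq_rpow]
    have hx0 : 0 < Real.sqrt x := Real.sqrt_pos.mpr (by linarith)
    field_simp
  have hJtheta : ∀ k : ℕ, Jint X δ G ((2 : ℝ) ^ (-((k : ℝ) + 2))) ≤
      K * D * (2 : ℝ) ^ ((k : ℝ) + 2) * Real.exp (-Real.log G * (2 : ℝ) ^ (-((k : ℝ) + 2))) := by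
    intro k
    obtain ⟨c1, c2, c3⟩ := hside G hG1.le le_rfl
    have hθ0 : 0 < (2 : ℝ) ^ (-((k : ℝ) + 2)) := Real.rpow_pos_of_pos two_pos _
    have hθ1 : (2 : ℝ) ^ (-((k : ℝ) + 2)) ≤ 1 / 2 := by
      rw [show (1 / 2 : ℝ) = (2 : ℝ) ^ (-(1 : ℝ)) by rw [Real.rpow_neg_one]; norm_num]
      exact Real.rpow_le_rpow_of_exponent_le one_le_two (by have := Nat.cast_nonneg (α := ℝ) k; linarith)
    have h := hJ X hX3 δ hδ hδ1.le _ hθ0 hθ1 G hG1.le c1 c2 c3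
    rw [← hLxdef] at h
    refine h.trans (le_of_eq ?_)
    have hG0 : 0 < G := by linarith
    rw [hD, Real.rpow_def_of_pos hG0, Real.rpow_neg zero_le_two ((k : ℝ) + 2)]
    have : Real.exp (Real.log G * ((2 : ℝ) ^ ((k : ℝ) + 2))⁻¹) ≠ 0 := (Real.exp_pos _).ne'
    have h2 : (2 : ℝ) ^ ((k : ℝ) + 2) ≠ 0 := (Real.rpow_pos_of_pos two_pos _).ne'
    rw [show -Real.log G * ((2 : ℝ) ^ ((k : ℝ) + 2))⁻¹ = -(Real.log G * ((2 : ℝ) ^ ((k : ℝ) + 2))⁻¹) by ring,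
      Real.exp_neg]
    field_simp
  -- I₁
  have hI1 : ∫ u in Ioc 1 G, ‖gfun X δ u‖ ^ 2 ≤ (Real.log G / Real.log 2 + 1) * (Real.sqrt 2 * (2 * K * D)) :=
    integral_Ioc_one_le_dyadic hX0 hs0 hG1.le (by positivity) hJhalf
  -- I₂ = tail on (G, x₁] + Gaussian tail
  set N : ℕ := ⌈2 * L⌉₊ with hN
  have hNlog : Real.log x₁ ≤ N := by rw [hlogx₁]; exact Nat.le_ceil _
  have hI2a := integral_tail_log_le_sum hX0 hs0 hG1.le hlogG4 hNlog
  have hI2b : ∫ u in Ioi x₁, ‖gfun X δ u‖ ^ 2 / Real.log u ^ 2 ≤ 1 := by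
    refine le_trans ?_ (HT δ hδ hδT)
    refine setIntegral_mono_on ?_ (integrableOn_norm_gfun_sq hX0 hs0 hx₁1) measurableSet_Ioi fun u hu ↦ ?_
    · refine Integrable.mono' (integrableOn_norm_gfun_sq hX0 hs0 hx₁1) ?_ ?_
      · refine ContinuousOn.aestronglyMeasurable ?_ measurableSet_Ioi
        refine (((continuousOn_gfun hX0 hs0).norm.pow 2).mono fun u hu ↦ hx₁1.trans (le_of_lt hu)).div
          ((Real.continuousOn_log.mono fun u hu ↦ ?_).pow 2) fun u hu ↦ ?_
        · exact ne_of_gt (lt_of_lt_of_le one_pos (hx₁1.trans (le_of_lt hu)))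
        · have : 0 < Real.log u := Real.log_pos (lt_of_le_of_lt hx₁1 hu) |>.trans_le' le_rfl
          positivity
      · refine (ae_restrict_iff' measurableSet_Ioi).mpr (Eventually.of_forall fun u hu ↦ ?_)
        rw [Real.norm_eq_abs, abs_of_nonneg (by positivity)]
        have hlog1 : 1 ≤ Real.log u := by
          have : Real.log x₁ ≤ Real.log u := Real.log_le_log (by linarith) (le_of_lt hu)
          rw [hlogx₁] at this; linarith
        rw [div_le_iff₀ (by positivity)]
        calc ‖gfun X δ u‖ ^ 2 = ‖gfun X δ u‖ ^ 2 * 1 := (mul_one _).symm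
          _ ≤ ‖gfun X δ u‖ ^ 2 * Real.log u ^ 2 := mul_le_mul_of_nonneg_left (one_le_pow₀ hlog1) (sq_nonneg _)
    · have hlog1 : 1 ≤ Real.log u := by
        have : Real.log x₁ ≤ Real.log u := Real.log_le_log (by linarith) (le_of_lt hu)
        rw [hlogx₁] at this; linarith
      rw [div_le_iff₀ (by positivity)]
      calc ‖gfun X δ u‖ ^ 2 = ‖gfun X δ u‖ ^ 2 * 1 := (mul_one _).symm
        _ ≤ ‖gfun X δ u‖ ^ 2 * Real.log u ^ 2 := mul_le_mul_of_nonneg_left (one_le_pow₀ hlog1) (sq_nonneg _)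
  have hI2split : ∫ x in Ioi G, ‖gfun X δ x‖ ^ 2 / Real.log x ^ 2 =
      (∫ u in Ioc G x₁, ‖gfun X δ u‖ ^ 2 / Real.log u ^ 2) + ∫ u in Ioi x₁, ‖gfun X δ u‖ ^ 2 / Real.log u ^ 2 := by
    have hglog : IntegrableOn (fun x : ℝ ↦ ‖gfun X δ x‖ ^ 2 / Real.log x ^ 2) (Ioi G) := by
      refine Integrable.mono' (integrableOn_norm_gfun_sq hX0 hs0 hG1.le) ?_ ?_
      · refine ContinuousOn.aestronglyMeasurable ?_ measurableSet_Ioi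
        refine (((continuousOn_gfun hX0 hs0).norm.pow 2).mono fun u hu ↦ hG1.le.trans (le_of_lt hu)).div
          ((Real.continuousOn_log.mono fun u hu ↦ ?_).pow 2) fun u hu ↦ ?_
        · exact ne_of_gt (lt_trans (by linarith) hu)
        · have : 0 < Real.log u := Real.log_pos (hG1.trans hu)
          positivity
      · refine (ae_restrict_iff' measurableSet_Ioi).mpr (Eventually.of_forall fun u hu ↦ ?_)
        rw [Real.norm_eq_abs, abs_of_nonneg (by positivity)]
        have hlog1 : 1 ≤ Real.log u := by
          have : Real.log G ≤ Real.log u := Real.log_le_log (by linarith) (le_of_lt hu)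
          linarith
        rw [div_le_iff₀ (by positivity)]
        calc ‖gfun X δ u‖ ^ 2 = ‖gfun X δ u‖ ^ 2 * 1 := (mul_one _).symm
          _ ≤ ‖gfun X δ u‖ ^ 2 * Real.log u ^ 2 := mul_le_mul_of_nonneg_left (one_le_pow₀ hlog1) (sq_nonneg _)
    have hdisj : Disjoint (Ioc G x₁) (Ioi x₁) := Set.disjoint_left.mpr fun u hu hu' ↦ (not_lt.mpr hu.2) hu'
    rw [← Ioc_union_Ioi_eq_Ioi hGx₁, setIntegral_union hdisj measurableSet_Ioi
      (hglog.mono_set Ioc_subset_Ioi_self) (hglog.mono_set (Ioi_subset_Ioi hGx₁))]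
  -- the finite `θ`-sum
  have hsum : 4 * ∑ k ∈ Finset.range N, (2 : ℝ) ^ (-(2 * (k : ℝ) + 3)) * Jint X δ G ((2 : ℝ) ^ (-((k : ℝ) + 2))) ≤
      4 * (K * D) * (18 / Real.log G) := by
    have hstep : ∀ k ∈ Finset.range N, (2 : ℝ) ^ (-(2 * (k : ℝ) + 3)) * Jint X δ G ((2 : ℝ) ^ (-((k : ℝ) + 2))) ≤
        (K * D) * ((2 : ℝ) ^ (-((k : ℝ) + 1)) * Real.exp (-Real.log G * (2 : ℝ) ^ (-((k : ℝ) + 2)))) := by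
      intro k _
      calc _ ≤ (2 : ℝ) ^ (-(2 * (k : ℝ) + 3)) * (K * D * (2 : ℝ) ^ ((k : ℝ) + 2) *
            Real.exp (-Real.log G * (2 : ℝ) ^ (-((k : ℝ) + 2)))) :=
            mul_le_mul_of_nonneg_left (hJtheta k) (by positivity)
        _ = _ := by
            have : (2 : ℝ) ^ (-(2 * (k : ℝ) + 3)) * (2 : ℝ) ^ ((k : ℝ) + 2) = (2 : ℝ) ^ (-((k : ℝ) + 1)) := by
              rw [← Real.rpow_add two_pos]; ring_nf
            calc _ = K * D * ((2 : ℝ) ^ (-(2 * (k : ℝ) + 3)) * (2 : ℝ) ^ ((k : ℝ) + 2)) *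
                  Real.exp (-Real.log G * (2 : ℝ) ^ (-((k : ℝ) + 2))) := by ring
              _ = _ := by rw [this]; ring
    calc _ ≤ 4 * ∑ k ∈ Finset.range N, (K * D) * ((2 : ℝ) ^ (-((k : ℝ) + 1)) *
          Real.exp (-Real.log G * (2 : ℝ) ^ (-((k : ℝ) + 2)))) := by
          exact mul_le_mul_of_nonneg_left (Finset.sum_le_sum hstep) (by norm_num)
      _ = 4 * (K * D) * ∑ k ∈ Finset.range N, (2 : ℝ) ^ (-((k : ℝ) + 1)) *
          Real.exp (-Real.log G * (2 : ℝ) ^ (-((k : ℝ) + 2))) := by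
          simp only [Finset.mul_sum]
          exact Finset.sum_congr rfl fun k _ ↦ by ring
      _ ≤ 4 * (K * D) * (18 / Real.log G) :=
          mul_le_mul_of_nonneg_left (sum_geom_exp_le (by linarith) N) (by positivity)
  -- the `P₀²` term and the constant term against `H D`
  have hX2s : X ^ 2 * Real.sqrt δ = δ ^ (1 / 2 - 2 * c) := by
    rw [hXpow 2, hsqδ, ← Real.rpow_add hδ]; push_cast; ring_nf
  have hP : 8 * H ^ 2 * phiProd X ^ 2 ≤ H * D / (2 * π) := by
    have hPb := abs_phiProd_le hX1
    have hP2 : phiProd X ^ 2 ≤ (2 * X * ((1 + c) * L)) ^ 2 := by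
      calc phiProd X ^ 2 = |phiProd X| ^ 2 := (sq_abs _).symm
        _ ≤ (2 * X * (1 + Real.log X)) ^ 2 := pow_le_pow_left₀ (abs_nonneg _) hPb 2
        _ ≤ _ := by gcongr
    have h4 := HP δ hδ hδP
    have hkey : 16 * π * phiProd X ^ 2 * Real.sqrt δ ≤ a := by
      calc 16 * π * phiProd X ^ 2 * Real.sqrt δ ≤ 16 * π * (2 * X * ((1 + c) * L)) ^ 2 * Real.sqrt δ := by gcongr
        _ = 64 * π * (1 + c) ^ 2 * (X ^ 2 * Real.sqrt δ) * L ^ 2 := by ring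
        _ = a * (64 * π * (1 + c) ^ 2 / a * δ ^ (1 / 2 - 2 * c) * L ^ 2) := by rw [hX2s]; field_simp
        _ ≤ a * 1 := mul_le_mul_of_nonneg_left h4 ha.le
        _ = a := mul_one a
    rw [le_div_iff₀ (by positivity)]
    have e1 : 8 * H ^ 2 * phiProd X ^ 2 * (2 * π) = H * (16 * π * phiProd X ^ 2 * Real.sqrt δ) * (H / Real.sqrt δ) := by
      field_simp
      ring
    have e2 : H * D = H * a * (H / Real.sqrt δ) := by rw [hD, hH]; field_simp
    rw [e1, e2]
    exact mul_le_mul_of_nonneg_right (mul_le_mul_of_nonneg_left hkey hH0.le) (by positivity)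
  have hR : 2 * π * 64 ≤ H * D := by
    rw [hHD, le_div_iff₀ (by positivity)]
    have h := HR δ hδ hδR
    calc 2 * π * 64 * (a * c ^ 2 * L ^ 2 * Real.sqrt δ) = 128 * π * a * c ^ 2 * δ ^ (1 / 2 : ℝ) * L ^ 2 := by
          rw [hsqδ]; ring
      _ ≤ 1 := h
  -- assemble: `2π · T_v ≤ C H D`
  have hlogG' : Real.log G / Real.log 2 + 1 ≤ 4 / H := by
    rw [hlogG]
    have hl9 := Real.log_two_gt_d9
    have hl0 : (0 : ℝ) < Real.log 2 := by linarith
    rw [div_div, div_add_one (by positivity), div_le_div_iff₀ (by positivity) hH0]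
    -- `(2 + H log 2) H ≤ 4 (H log 2)` since `H ≤ ½`, `log 2 > ½`
    have h1 : H * Real.log 2 ≤ 1 / 2 * Real.log 2 := mul_le_mul_of_nonneg_right hH12 hl0.le
    have h3 : 2 + H * Real.log 2 ≤ 4 * Real.log 2 := by linarith
    calc (2 + H * Real.log 2) * H ≤ 4 * Real.log 2 * H := mul_le_mul_of_nonneg_right h3 hH0.le
      _ = 4 * (H * Real.log 2) := by ring
  have hterm1 : 16 * H ^ 2 * ∫ u in Ioc 1 G, ‖gfun X δ u‖ ^ 2 ≤ 128 * Real.sqrt 2 * K * (H * D) := by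
    calc 16 * H ^ 2 * ∫ u in Ioc 1 G, ‖gfun X δ u‖ ^ 2 ≤ 16 * H ^ 2 * ((4 / H) * (Real.sqrt 2 * (2 * K * D))) := by
          refine mul_le_mul_of_nonneg_left (hI1.trans ?_) (by positivity)
          exact mul_le_mul_of_nonneg_right hlogG' (by positivity)
      _ = 128 * Real.sqrt 2 * K * (H * D) := by field_simp; norm_num
  have hterm3 : 64 * ∫ x in Ioi G, ‖gfun X δ x‖ ^ 2 / Real.log x ^ 2 ≤ 2304 * K * (H * D) + 64 := by
    rw [hI2split]
    have h1 : ∫ u in Ioc G x₁, ‖gfun X δ u‖ ^ 2 / Real.log u ^ 2 ≤ 4 * (K * D) * (18 / Real.log G) := hI2a.trans hsum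
    rw [hlogG] at h1
    have : 4 * (K * D) * (18 / (2 / H)) = 36 * K * (H * D) := by field_simp; norm_num
    rw [this] at h1
    linarith
  -- final linear combination
  have hE0 : 0 ≤ H * D := by positivity
  have h2π : 0 ≤ 2 * π := by positivity
  have hP' : 2 * π * (8 * H ^ 2 * phiProd X ^ 2) ≤ H * D := by
    have := hP; rw [le_div_iff₀ (by positivity)] at this; linarith
  have A := mul_le_mul_of_nonneg_left hTv h2π
  have B := mul_le_mul_of_nonneg_left hterm1 h2π
  have C := mul_le_mul_of_nonneg_left hterm3 h2π
  have hEπ : 2 * (H * D) ≤ 4 * π * (H * D) := by nlinarith [Real.pi_gt_three]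
  have hgoal : π * (2 * ∫ v in Ioi (0 : ℝ), ‖ftil X δ v * kWin H v‖ ^ 2) ≤
      2 * π * (128 * Real.sqrt 2 * K + 2304 * K + 2) * (H * D) := by
    linarith [A, B, C, hP', hR, hEπ]
  calc π * (2 * ∫ v in Ioi (0 : ℝ), ‖ftil X δ v * kWin H v‖ ^ 2)
      ≤ 2 * π * (128 * Real.sqrt 2 * K + 2304 * K + 2) * (H * D) := hgoal
    _ = 2 * π * (128 * Real.sqrt 2 * K + 2304 * K + 2) * H / (Real.sqrt δ * Lx) := by
        rw [hD, mul_one_div, ← mul_div_assoc]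

end Literature.NumberTheory.LFunctions.SelbergMollifier
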